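import Mathlib
import HarnessLib
import Summits.QuantumAdvantage.AdviceFreeQNC0.OddPrimeTransport
import Summits.QuantumAdvantage.AdviceFreeQNC0.OddPrimeWitnesses
import Summits.QuantumAdvantage.AdviceFreeQNC0.WalkHardFJunta
import Summits.QuantumAdvantage.AdviceFreeQNC0.DWalkOneBell
import Summits.QuantumAdvantage.QuantumAdvantage.Theorems.WalkThreeCharge
import Summits.QuantumAdvantage.AdviceFreeQNC0.ExactHit

/-!
# RigidityLaws — two-charge (rigidity) laws of the odd-prime u-walk game (cell decomp-qadv, lens 4, gen 10)

Supports tree item 26994 (`FeatureShadow.Target` : `∀ p ≥ 5 prime, WalkHardF p`) with its first NECESSARY CONDITION at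
the two-charge level, the exact extremal window of that condition, the group law of strategies, and the `p = 3`
calibration — all sorry-free over landed modules only (`WalkThreeCharge`, `OddPrimeTransport`, `OddPrimeWitnesses`,
`WalkHardFJunta`, `DWalkOneBell`).  The workshop node (`pub/decomp-qadv/decomp-qadv-lens-4/g10/RigidityDial.lean`)
states the same content against named `Prop`s; here every statement is INLINED (no `def … : Prop`).

## Content

By the landed three-charge identity (`Coset21.threeCharge_holds`: `WIN_c ⊕ WIN_{c+1} = WIN_{c+2}`) an input is, for a
given strategy `y`, either DEAD (loses at all three charges) or wins at EXACTLY two.  Call `y` RIGID at `k` on `u`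
when it wins at both `k+1` and `k+2`.  In the landed odd-one-out frame (`Coset21.oddOneOutForm_holds`):
WIN at `c` ⟺ `nae₀ ∧ oddOneOut ≢ -(wt u + c)` (the register statistic AVOIDS the hidden residue), and
RIGID at `k` ⟺ `nae₀ ∧ oddOneOut ≡ -(wt u + k)` (it COMPUTES the hidden residue) — `rigid_iff_compute`.

* §1 rigidity-diagram identity `card_win_eq_sum`: `#WIN_c = #RIGID_{c+1} + #RIGID_{c+2}` exactly.
* §3 necessity `rigid_of_walkHardF`: `WalkHardF p` ⇒ the two-charge bound with the same constant (regime-generic: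
  `rigid_of_hard_regime`); calibration `rigid_two` at `p = 2`.
* §5 corners of the rigidity diagram by degree-0 strategies (`rigid_corner_third`: one shot `{0}` ↦ `(1/3, 1/3)`;
  `rigid_corner_twoThirds`: two shots `{0, n}` ↦ `(2/3, 0)`), hence `twoThirds_le_of_rigid_bound`: NO rigidity
  constant below `2/3` — the cheap lift "rigidity bound `θ` ⇒ win bound `2θ`" (`win_le_two_mul_of_rigid`) is vacuous,
  and a near-perfect avoider is FORCED to hedge between its two rigid classes (`rigid_parts_of_nearPerfect`).
* §6 group law: strategies under cutwise XOR (`xorStrat`) — degrees add (`hasDegF_xor`), `ringWinU` is a character at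
  every charge (`ringWinU_xorStrat`), near-perfect strategies form a coset of the near-null subgroup
  (`card_win_xorStrat_le`, `card_win_le_xorStrat_add`), rigid classes add like the Klein four-group
  (`rigid_xorStrat_of_ne`, `dead_xorStrat_of_eq`).
* §7 `p = 3`: the degree-2 `𝔽₃` strategy `rigidThree` on cuts `{0, 1}` is RIGID on EVERY input (`rigidEasyThree`),
  so the two-charge bound fails at `p = 3` exactly like the one-charge bound (`not_rigid_hard_three`, cf. the landed
  `not_walkHardF_three`); general two-cut evaluation `ringWinU_pair_iff`, `wtPrefix_one`.

0 sorry · axioms `[propext, Classical.choice, Quot.sound]` · no `native_decide` · no `def … : Prop` · no instance/notation.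
-/

namespace Summit.QuantumAdvantage.AdviceFreeQNC0.RigidityLaws

open Classical
open Finset
open Summit.QuantumAdvantage.AdviceFreeQNC0
open Literature.Computability.MetaComplexity Literature.Computability.MetaComplexity.Smolensky

variable {n : ℕ}

/-! ## §1 Charge periodicity and the three-charge law, pointwise -/

/-- `ringWinU` only depends on the charge mod 3. -/
theorem ringWinU_congr_mod (c c' : ℕ) (h : c % 3 = c' % 3) (y : Fin (n + 1) → (Fin n → Bool) → Bool)
    (u : Fin n → Bool) : ringWinU c y u = ringWinU c' y u := by
  unfold ringWinU
  have hf : (univ.filter fun g : Fin (n + 1) => y g u = true ∧ (c + g.val + walkExp u g.val) % 3 ≠ 0)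
      = (univ.filter fun g : Fin (n + 1) => y g u = true ∧ (c' + g.val + walkExp u g.val) % 3 ≠ 0) := by
    apply Finset.filter_congr
    intro g _
    have hg : (c + g.val + walkExp u g.val) % 3 = (c' + g.val + walkExp u g.val) % 3 := by omega
    rw [hg]
  rw [hf]

/-- the landed three-charge identity, pointwise. -/
theorem threeCharge (c : ℕ) (y : Fin (n + 1) → (Fin n → Bool) → Bool) (u : Fin n → Bool) :
    Bool.xor (ringWinU c y u) (ringWinU (c + 1) y u) = ringWinU (c + 2) y u :=
  Coset21.threeCharge_holds n c y u

/-- RIGID at `k` (wins at `k+1` and `k+2`) ⇒ LOSES at `k`. -/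
theorem lose_of_rigid (k : ℕ) (y : Fin (n + 1) → (Fin n → Bool) → Bool) (u : Fin n → Bool)
    (h1 : ringWinU (k + 1) y u = true) (h2 : ringWinU (k + 2) y u = true) : ringWinU k y u = false := by
  have h := threeCharge k y u
  rw [h1, h2] at h
  revert h
  cases ringWinU k y u <;> decide

/-- WIN at `c` ⇔ RIGID at `c+2` (wins `c, c+1`) or RIGID at `c+1` (wins `c+2, c`). -/
theorem win_iff_rigid_or (c : ℕ) (y : Fin (n + 1) → (Fin n → Bool) → Bool) (u : Fin n → Bool) :
    ringWinU c y u = true ↔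
      ((ringWinU c y u = true ∧ ringWinU (c + 1) y u = true) ∨
        (ringWinU c y u = true ∧ ringWinU (c + 2) y u = true)) := by
  have h := threeCharge c y u
  revert h
  cases ringWinU c y u <;> cases ringWinU (c + 1) y u <;> cases ringWinU (c + 2) y u <;> simp

/-- **Rigidity diagram identity.** `#WIN_c = #(WIN_c ∩ WIN_{c+1}) + #(WIN_c ∩ WIN_{c+2})`: the win set at one
charge is the DISJOINT union of the two rigid sets that contain it. -/
theorem card_win_eq_sum (c : ℕ) (y : Fin (n + 1) → (Fin n → Bool) → Bool) :
    (univ.filter fun u : Fin n → Bool => ringWinU c y u = true).card =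
      (univ.filter fun u : Fin n → Bool => ringWinU c y u = true ∧ ringWinU (c + 1) y u = true).card +
        (univ.filter fun u : Fin n → Bool => ringWinU c y u = true ∧ ringWinU (c + 2) y u = true).card := by
  have hinter : (univ.filter fun u : Fin n → Bool => ringWinU c y u = true ∧ ringWinU (c + 1) y u = true) ∩
      (univ.filter fun u : Fin n → Bool => ringWinU c y u = true ∧ ringWinU (c + 2) y u = true) = ∅ := by
    ext u
    simp only [mem_inter, mem_filter, mem_univ, true_and]
    have h := threeCharge c y u
    revert h
    cases ringWinU c y u <;> cases ringWinU (c + 1) y u <;> cases ringWinU (c + 2) y u <;> simp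
  have hunion : (univ.filter fun u : Fin n → Bool => ringWinU c y u = true ∧ ringWinU (c + 1) y u = true) ∪
      (univ.filter fun u : Fin n → Bool => ringWinU c y u = true ∧ ringWinU (c + 2) y u = true) =
        univ.filter fun u : Fin n → Bool => ringWinU c y u = true := by
    ext u
    simp only [mem_union, mem_filter, mem_univ, true_and]
    exact (win_iff_rigid_or c y u).symm
  rw [← Finset.card_union_add_card_inter, hinter, Finset.card_empty, add_zero, hunion]

/-! ## §2 The odd-one-out reading: AVOID (win) versus COMPUTE (rigid) -/

/-- landed: WIN at `c` ⇔ the register is not-all-equal and its odd-one-out class AVOIDS `-(wt u + c)`. -/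
theorem win_iff_avoid (c : ℕ) (y : Fin (n + 1) → (Fin n → Bool) → Bool) (u : Fin n → Bool) :
    ringWinU c y u = true ↔ (Coset21.nae₀ y u ∧ (wt u + c + Coset21.oddOneOut y u) % 3 ≠ 0) :=
  Coset21.oddOneOutForm_holds n c y u

/-- **kernel of the dial**: RIGID at `k` ⇔ the register is not-all-equal and its odd-one-out class
COMPUTES `-(wt u + k)`. -/
theorem rigid_iff_compute (k : ℕ) (y : Fin (n + 1) → (Fin n → Bool) → Bool) (u : Fin n → Bool) :
    (ringWinU (k + 1) y u = true ∧ ringWinU (k + 2) y u = true) ↔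
      (Coset21.nae₀ y u ∧ (wt u + k + Coset21.oddOneOut y u) % 3 = 0) := by
  rw [win_iff_avoid (k + 1) y u, win_iff_avoid (k + 2) y u]
  constructor
  · rintro ⟨⟨hn, h1⟩, -, h2⟩
    exact ⟨hn, by omega⟩
  · rintro ⟨hn, h0⟩
    exact ⟨⟨hn, by omega⟩, hn, by omega⟩

/-- the win set at `c` is the AVOID set of the odd-one-out frame. -/
theorem winSet_eq_avoidSet (c : ℕ) (y : Fin (n + 1) → (Fin n → Bool) → Bool) :
    (univ.filter fun u : Fin n → Bool => ringWinU c y u = true) =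
      univ.filter fun u : Fin n → Bool =>
        Coset21.nae₀ y u ∧ (wt u + c + Coset21.oddOneOut y u) % 3 ≠ 0 :=
  Finset.filter_congr fun u _ => win_iff_avoid c y u

/-- the rigid set at `k` is the COMPUTE set of the odd-one-out frame. -/
theorem rigidSet_eq_computeSet (k : ℕ) (y : Fin (n + 1) → (Fin n → Bool) → Bool) :
    (univ.filter fun u : Fin n → Bool => ringWinU (k + 1) y u = true ∧ ringWinU (k + 2) y u = true) =
      univ.filter fun u : Fin n → Bool =>
        Coset21.nae₀ y u ∧ (wt u + k + Coset21.oddOneOut y u) % 3 = 0 :=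
  Finset.filter_congr fun u _ => rigid_iff_compute k y u

/-! ## §3 Necessity: the one-charge bound implies the two-charge bound (same constant) -/

/-- regime-generic monotonicity: wherever the one-charge bound is proved, the two-charge bound holds with the
same constant (apply the one-charge bound at charge `k+1`). -/
theorem rigid_of_hard_regime (p : ℕ) [Fact p.Prime] (θ : ℝ)
    (R : ∀ {n : ℕ}, ℕ → (Fin (n + 1) → (Fin n → Bool) → Bool) → Prop)
    (h : ∀ C : ℕ, ∃ n₀ : ℕ, ∀ n ≥ n₀, ∀ c : ℕ, ∀ y : Fin (n + 1) → (Fin n → Bool) → Bool,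
      (∀ g, HasDegF p (y g) ((Nat.log 2 n) ^ C)) → R C y →
        ((univ.filter fun u : Fin n → Bool => ringWinU c y u = true).card : ℝ) ≤ θ * (2 : ℝ) ^ n) :
    ∀ C : ℕ, ∃ n₀ : ℕ, ∀ n ≥ n₀, ∀ k : ℕ, ∀ y : Fin (n + 1) → (Fin n → Bool) → Bool,
      (∀ g, HasDegF p (y g) ((Nat.log 2 n) ^ C)) → R C y →
        ((univ.filter fun u : Fin n → Bool =>
            ringWinU (k + 1) y u = true ∧ ringWinU (k + 2) y u = true).card : ℝ) ≤ θ * (2 : ℝ) ^ n := by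
  intro C
  obtain ⟨n₀, hn₀⟩ := h C
  refine ⟨n₀, fun n hn k y hy hR => le_trans ?_ (hn₀ n hn (k + 1) y hy hR)⟩
  exact_mod_cast Finset.card_le_card fun u hu => by
    simp only [Finset.mem_filter, Finset.mem_univ, true_and] at hu ⊢
    exact hu.1

/-- **Necessity.** `WalkHardF p` ⇒ the two-charge (rigidity) bound with the same constant `θ < 1`. -/
theorem rigid_of_walkHardF (p : ℕ) [Fact p.Prime] (h : WalkHardF p) :
    ∃ θ : ℝ, θ < 1 ∧ ∀ C : ℕ, ∃ n₀ : ℕ, ∀ n ≥ n₀, ∀ k : ℕ, ∀ y : Fin (n + 1) → (Fin n → Bool) → Bool,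
      (∀ g, HasDegF p (y g) ((Nat.log 2 n) ^ C)) →
        ((univ.filter fun u : Fin n → Bool =>
            ringWinU (k + 1) y u = true ∧ ringWinU (k + 2) y u = true).card : ℝ) ≤ θ * (2 : ℝ) ^ n := by
  obtain ⟨θ, hθ, hC⟩ := h
  refine ⟨θ, hθ, ?_⟩
  have := rigid_of_hard_regime p θ (fun _ _ => True)
    (fun C => by
      obtain ⟨n₀, hn₀⟩ := hC C
      exact ⟨n₀, fun n hn c y hy _ => hn₀ n hn c y hy⟩)
  intro C
  obtain ⟨n₀, hn₀⟩ := this C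
  exact ⟨n₀, fun n hn k y hy => hn₀ n hn k y hy trivial⟩

/-- calibration `p = 2`: the two-charge bound holds (from the landed `walkHardF_two`). -/
theorem rigid_two :
    ∃ θ : ℝ, θ < 1 ∧ ∀ C : ℕ, ∃ n₀ : ℕ, ∀ n ≥ n₀, ∀ k : ℕ, ∀ y : Fin (n + 1) → (Fin n → Bool) → Bool,
      (∀ g, HasDegF 2 (y g) ((Nat.log 2 n) ^ C)) →
        ((univ.filter fun u : Fin n → Bool =>
            ringWinU (k + 1) y u = true ∧ ringWinU (k + 2) y u = true).card : ℝ) ≤ θ * (2 : ℝ) ^ n :=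
  rigid_of_walkHardF 2 walkHardF_two

/-! ## §5 The extremal (blind) strategies: corner points of the rigidity diagram -/

/-- the blind strategy firing exactly the cuts in `S`, on every input. -/
def blind (S : Finset (Fin (n + 1))) : Fin (n + 1) → (Fin n → Bool) → Bool :=
  fun g _ => decide (g ∈ S)

/-- constant Boolean functions have every degree. -/
theorem hasDegF_const (p : ℕ) [Fact p.Prime] (b : Bool) (d : ℕ) :
    HasDegF p (fun _ : Fin n → Bool => b) d := by
  have h0 : HasDegF p (fun _ : Fin n → Bool => b) 0 := by
    simpa using hasDegF_of_junta (p := p) (∅ : Finset (Fin n)) (fun _ => b) (fun _ _ _ => rfl)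
  unfold HasDegF at h0 ⊢
  exact lowDeg_mono (Nat.zero_le d) h0

/-- blind strategies have degree `0` (hence every degree). -/
theorem hasDegF_blind (p : ℕ) [Fact p.Prime] (S : Finset (Fin (n + 1))) (g : Fin (n + 1)) (d : ℕ) :
    HasDegF p (blind S g) d :=
  hasDegF_const p (decide (g ∈ S)) d

/-- the walk exponent at cut `0` is `wt u`. -/
theorem walkExp_zero (u : Fin n → Bool) : walkExp u 0 = wt u := by
  simp [walkExp, wtPrefix]

/-- the walk exponent at the last cut `n` is `2·wt u`. -/
theorem walkExp_self (u : Fin n → Bool) : walkExp u n = wt u + wt u := by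
  simp only [walkExp, wtPrefix, wt]
  congr 1
  exact congrArg Finset.card (Finset.filter_congr fun i _ => ⟨fun h => h.2, fun h => ⟨i.isLt, h⟩⟩)

/-- evaluation of `ringWinU` for a blind strategy: parity of the live cuts of `S`. -/
theorem ringWinU_blind (S : Finset (Fin (n + 1))) (c : ℕ) (u : Fin n → Bool) :
    ringWinU c (blind S) u = true ↔
      (S.filter fun g => (c + g.val + walkExp u g.val) % 3 ≠ 0).card % 2 = 1 := by
  unfold ringWinU blind
  rw [decide_eq_true_iff]
  have hS : (univ.filter fun g : Fin (n + 1) =>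
      decide (g ∈ S) = true ∧ (c + g.val + walkExp u g.val) % 3 ≠ 0) =
        S.filter fun g => (c + g.val + walkExp u g.val) % 3 ≠ 0 := by
    ext g
    simp
  rw [hS]

/-- the one-shot strategy `{0}` wins at `c` iff `c + wt u ≢ 0`. -/
theorem ringWinU_blindZero (c : ℕ) (u : Fin n → Bool) :
    ringWinU c (blind ({0} : Finset (Fin (n + 1)))) u = true ↔ (c + wt u) % 3 ≠ 0 := by
  rw [ringWinU_blind, Finset.filter_singleton]
  simp only [Fin.val_zero, add_zero, walkExp_zero]
  split_ifs with h <;> simp [h]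

/-- the two-shot strategy `{0, n}`: live status of its two cuts. -/
theorem ringWinU_blindEnds (hn : 1 ≤ n) (c : ℕ) (u : Fin n → Bool) :
    ringWinU c (blind ({0, Fin.last n} : Finset (Fin (n + 1)))) u = true ↔
      (((c + wt u) % 3 ≠ 0 ∧ (c + n + (wt u + wt u)) % 3 = 0) ∨
        ((c + wt u) % 3 = 0 ∧ (c + n + (wt u + wt u)) % 3 ≠ 0)) := by
  have h0l : (0 : Fin (n + 1)) ∉ ({Fin.last n} : Finset (Fin (n + 1))) := by
    rw [Finset.mem_singleton]
    intro h
    have := congrArg Fin.val h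
    simp at this
    omega
  rw [ringWinU_blind, Finset.filter_insert, Finset.filter_singleton]
  simp only [Fin.val_zero, add_zero, walkExp_zero, Fin.val_last, walkExp_self]
  by_cases hA : (c + wt u) % 3 = 0 <;> by_cases hB : (c + n + (wt u + wt u)) % 3 = 0 <;>
    simp [hA, hB, h0l]


end Summit.QuantumAdvantage.AdviceFreeQNC0.RigidityLaws
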